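import Literature.MathematicalPhysics.QuantumLattice.FermionGroundStateRangeIndependence
import Literature.MathematicalPhysics.QuantumLattice.ErgodicStatesODLROProofs
import Literature.MathematicalPhysics.QuantumLattice.InfVolFermionStateGaugeCommutator
import Literature.MathematicalPhysics.QuantumLattice.TranslationInvariantFermionStatesAreEven
import Literature.MathematicalPhysics.QuantumLattice.PairSourceWindowLocalHamiltonian
import Literature.MathematicalPhysics.QuantumLattice.SparseKrausPerturbedStateEnergy
import HarnessLib

/-!
# Translation-invariant ground states at TWO chemical potentials are gauge invariant
# («a charge gap excludes every `U(1)`-breaking order; incompressible ⇒ not superfluid»)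

Topic `Literature/MathematicalPhysics/QuantumLattice` (namespace = path). Family `hubbard`, crew hubbard-obs
(D-0042 / D-0082 (c) «cuprate question»), seat `hubbard-obs-gs-2` g4 (ground-state row theory). Everything is
PROVED (std axioms, no `sorry`, no definition, no named fact); lattice fermions on `ℤ^d` in the tree's
`InfVolFermionState` / `FermionInteraction` vocabulary.

THE STATEMENT (`InfVolFermionState.IsTranslationInvariant.isGaugeInvariant_of_isGroundState_pencil_two`): let `Ψ`
be an even, finite-range (`R ≥ 0`), translation-covariant interaction on `ℤ^d`, `d ≥ 1`, and `ω` a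
translation-invariant state which is a Bratteli–Robinson ground state (`IsGroundState`: `−iω(A⋆δ(A)) ≥ 0`) of
the pencil `Ψ − μ₁ n` AND of `Ψ − μ₂ n` for two chemical potentials `μ₁ < μ₂`. Then `ω` is gauge invariant
(`ω ∘ γ_θ = ω`), i.e. `ω(A) = 0` for every local observable of nonzero particle charge
(`…expect_eq_zero_of_hasGaugeCharge_of_isGroundState_pencil_two`). For the `t–t'` Hubbard pencil
`hubbardTTPrimeMuInteraction t t' U μ` on `ℤ²` (§5): `…_hubbardTTPrimeMu_two`, and every singlet-pair amplitude
`ω(localPairAt S g x)` vanishes. With the tree's Bratteli–Kishimoto–Robinson files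
(`TorusLimitAsymptoticGroundStateFamilies`, `TorusLimitSectorGroundStatesChargedRows`: torus limits of
asymptotically-ground-state families at density `n` are ground states of `H^{tt'} − μN` for EVERY
`μ ∈ [μ₋(n), μ₊(n)]`) this reads: at a density where the energy density `e(n)` has a KINK (a charge gap,
`μ₋(n) < μ₊(n)`) no translation-invariant ground state breaks the particle-number symmetry — in particular no
pair (ODLRO) amplitude; the Summits-side consumer turns `0 < chargeGapTT'` into a zero pair-LRO ceiling.

THE ARGUMENT (§3, `two_mul_charge_mul_sq_le_of_isGroundState_pencil_two`). Recentre: `K = Ψ − ½(μ₁+μ₂)n`,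
`δ = ½(μ₂−μ₁) > 0`, so `ω` is a ground state of `K − δn` and of `K + δn`. For an even local `A ∈ 𝔄_Λ` of charge
`q > 0` and a finite set `S` of translations put `B = Σ_{x∈S} τ_x A`. The ground-state inequality of `K − δn` on
`B` and of `K + δn` on `B⋆` (`[N, B] = qB`) read `δq·ω(B⋆B) ≤ Re ω(B⋆[H^K,B])`, `δq·ω(BB⋆) ≤ Re ω(B[H^K,B⋆])`;
their sum is, by stationarity (`ω([H, BB⋆]) = 0`), the double commutator `Re ω([B⋆,[H^K_{Λ'}, B]])`. Expanding in
pairs of translates, Araki–Moriya's `[H_{Λ'}, τ_x A] = [H_{thicken(Λ+x) R}, τ_x A]` and graded locality kill every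
pair with `y − x ∉ Z = thicken Λ R − Λ`, and the rest are bounded by `4‖A‖²‖H^K_{thicken(Λ+x)R}‖ ≤ 4‖A‖² M_H`
uniformly (translation covariance + finite range bound the terms of `K`, §1), so the double commutator is
`≤ |S|·|Z|·4‖A‖² M_H`, while Cauchy–Schwarz and translation invariance give `ω(B⋆B), ω(BB⋆) ≥ |ω(B)|² =
|S|²|ω(A)|²`. On the boxes `S = [0,ℓ)^d`: `2δq ℓ^{2d}|ω(A)|² ≤ C ℓ^d` for all `ℓ`, hence `ω(A) = 0`. Odd charges
are odd observables, killed by `IsTranslationInvariant.isEven`; negative charges by `A ↦ A⋆`; gauge invariance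
by the matrix-unit decomposition of `isGaugeInvariant_of_forall_expect_commutator`.

PRINTED PRECEDENT / HONEST SCOPE. The implication «off-diagonal long-range order ⇒ no cusp of `e(ρ)` (no jump of
the chemical potential)» is printed for hard-core lattice BOSONS by a finite-volume trial-state argument
(Aizenman–Lieb–Seiringer–Solovej–Yngvason 2004 §IV, as reported in Lieb–Seiringer–Solovej–Yngvason 2005 §11.3,
eq. (11.29)–(11.30): «the particle number should go up by `ε|Λ|`, but the energy only by `ε²|Λ|`»). This file is
the infinite-volume, lattice-FERMION, Bratteli–Robinson-ground-state form of the same mechanism; no number, no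
certificate, no order parameter is bounded away from zero here, and nothing says whether any particular density
of the Hubbard model HAS a charge gap (a kink of `e(n)` is not certifiable from energy windows of positive width).

## Contents
* §1 helpers: Cauchy–Schwarz `‖ω(B)‖² ≤ Re ω(B⋆B)`, `≤ Re ω(BB⋆)`; a counting lemma for translation double sums;
  `‖H^Ψ_S‖ ≤ 2^{|S|} M`; translation covariance + finite range ⇒ uniformly bounded terms; `|thicken S R| ≤ |S||box|`.
* §2 `pencil_pencil`.
* §3 THE KEY ESTIMATE `two_mul_charge_mul_sq_le_of_isGroundState_pencil_two`.
* §4 `expect_eq_zero_of_parityAut_eq_of_pos_charge_…`, `expect_eq_zero_of_hasGaugeCharge_…`,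
  `isGaugeInvariant_of_isGroundState_pencil_two` (general `d ≥ 1`).
* §5 the `t–t'` Hubbard pencil on `ℤ²`: `isGaugeInvariant_of_isGroundState_hubbardTTPrimeMu_two`,
  `expect_eq_zero_of_hasGaugeCharge_…_hubbardTTPrimeMu_two`, `expect_localPairAt_eq_zero_…_hubbardTTPrimeMu_two`.

## References
* O. Bratteli, D. W. Robinson, *Operator Algebras and Quantum Statistical Mechanics 2*, 2nd ed. (Springer 1997),
  Def. 5.3.18 / Prop. 5.3.19 (ground states), §5.2.2 (gauge group of the CAR algebra), Thm. 6.2.4 (local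
  dynamics of finite-range interactions). [BratteliRobinsonII1997]
* O. Bratteli, A. Kishimoto, D. W. Robinson, Commun. Math. Phys. 64 (1978) 41–48, §1 and Thm. 2.
  [BratteliKishimotoRobinson1978]
* H. Araki, H. Moriya, Rev. Math. Phys. 15 (2003) 93, §4.1 (translation-invariant states are even), Thm. 5.7.
  [ArakiMoriya2003]
* E. H. Lieb, R. Seiringer, J. P. Solovej, J. Yngvason, *The Mathematics of the Bose Gas and its Condensation*
  (Birkhäuser 2005), §11.3 eq. (11.29)–(11.30) (BEC ⇒ no cusp of `e(ρ)`, hard-core lattice bosons). [LSSY2005]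
* T. Koma, H. Tasaki, J. Stat. Phys. 76 (1994) 745–803, §1 (obscured symmetry breaking; the `U(1)` tower). [KomaTasaki1994]
-/

noncomputable section

namespace Literature.MathematicalPhysics.QuantumLattice

open Matrix Finset Complex HubbardWave0 Literature.Probability.LatticeModels
open scoped ComplexOrder

variable {d : ℕ}

/-! ### §1. Generic helpers -/

section Helpers

open scoped Matrix.Norms.L2Operator

namespace InfVolFermionState

/-- **Cauchy–Schwarz for a state**: `‖ω(B)‖² ≤ Re ω(BᴴB)` (positivity of `ω((B − ω(B)𝟙)ᴴ(B − ω(B)𝟙))`,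
`ω(𝟙) = 1`). [cite: BratteliRobinsonI1987, Lemma 2.3.10] -/
theorem norm_sq_expect_le_re_expect_conjTranspose_mul_self (ω : InfVolFermionState d) (Λ : Finset (Site d))
    (B : FermionOp Λ) : ‖ω.expect Λ B‖ ^ 2 ≤ (ω.expect Λ (Bᴴ * B)).re := by
  set c : ℂ := ω.expect Λ B with hc
  have hpos := ω.expect_nonneg Λ (B - c • (1 : FermionOp Λ))
  have hexp : (B - c • (1 : FermionOp Λ))ᴴ * (B - c • (1 : FermionOp Λ)) =
      Bᴴ * B - c • Bᴴ - (star c) • B + (star c * c) • (1 : FermionOp Λ) := by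
    rw [Matrix.conjTranspose_sub, Matrix.conjTranspose_smul, Matrix.conjTranspose_one, sub_mul, mul_sub,
      mul_sub, Matrix.smul_mul, Matrix.mul_smul, Matrix.smul_mul, Matrix.mul_smul, mul_one, one_mul, one_mul,
      smul_smul]
    abel
  rw [hexp, map_add, map_sub, map_sub, map_smul, map_smul, map_smul, ω.expect_one, ω.expect_conjTranspose,
    ← hc, smul_eq_mul, smul_eq_mul, smul_eq_mul, mul_one] at hpos
  have hre := (Complex.nonneg_iff.1 hpos).1
  simp only [Complex.sub_re, Complex.add_re, Complex.mul_re, Complex.star_def, Complex.conj_re,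
    Complex.conj_im] at hre
  have hn : ‖c‖ ^ 2 = c.re * c.re + c.im * c.im := by
    rw [Complex.sq_norm, Complex.normSq_apply]
  rw [hn]
  nlinarith [hre]

/-- `‖ω(B)‖² ≤ Re ω(BBᴴ)` (Cauchy–Schwarz for `Bᴴ`, `‖ω(Bᴴ)‖ = ‖ω(B)‖`). [cite: BratteliRobinsonI1987, Lemma 2.3.10] -/
theorem norm_sq_expect_le_re_expect_mul_conjTranspose_self (ω : InfVolFermionState d) (Λ : Finset (Site d))
    (B : FermionOp Λ) : ‖ω.expect Λ B‖ ^ 2 ≤ (ω.expect Λ (B * Bᴴ)).re := by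
  have h := ω.norm_sq_expect_le_re_expect_conjTranspose_mul_self Λ Bᴴ
  rwa [Matrix.conjTranspose_conjTranspose, ω.expect_conjTranspose, Complex.star_def, Complex.norm_conj] at h

end InfVolFermionState

/-- **Counting lemma for translation double sums**: if `f x y` vanishes unless `y − x ∈ Z` and is bounded by
`K`, then `‖Σ_{x,y ∈ S} f x y‖ ≤ |S| · |Z| · K`. [folklore] -/
private theorem norm_sum_sum_le_card_mul_of_sub_mem {β : Type*} [SeminormedAddCommGroup β] (S Z : Finset (Site d))
    (f : Site d → Site d → β) {K : ℝ} (hK : 0 ≤ K) (hzero : ∀ x ∈ S, ∀ y ∈ S, y - x ∉ Z → f x y = 0)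
    (hbound : ∀ x ∈ S, ∀ y ∈ S, ‖f x y‖ ≤ K) :
    ‖∑ x ∈ S, ∑ y ∈ S, f x y‖ ≤ #S * (#Z * K) := by
  classical
  have hrow : ∀ x ∈ S, ‖∑ y ∈ S, f x y‖ ≤ #Z * K := by
    intro x hx
    rw [← Finset.sum_filter_of_ne (p := fun y => y - x ∈ Z) (fun y hy hne => by
      by_contra h; exact hne (hzero x hx y hy h))]
    calc ‖∑ y ∈ S.filter (fun y => y - x ∈ Z), f x y‖
        ≤ ∑ y ∈ S.filter (fun y => y - x ∈ Z), ‖f x y‖ := norm_sum_le _ _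
      _ ≤ ∑ y ∈ S.filter (fun y => y - x ∈ Z), K :=
          Finset.sum_le_sum fun y hy => hbound x hx y (Finset.mem_filter.1 hy).1
      _ = #(S.filter (fun y => y - x ∈ Z)) * K := by rw [Finset.sum_const, nsmul_eq_mul]
      _ ≤ #Z * K := by
          refine mul_le_mul_of_nonneg_right ?_ hK
          exact_mod_cast Finset.card_le_card_of_injOn (fun y => y - x)
            (fun y hy => by exact (Finset.mem_filter.1 (Finset.mem_coe.1 hy)).2)
            (fun y _ y' _ h => sub_left_injective h)
  calc ‖∑ x ∈ S, ∑ y ∈ S, f x y‖ ≤ ∑ x ∈ S, ‖∑ y ∈ S, f x y‖ := norm_sum_le _ _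
    _ ≤ ∑ x ∈ S, #Z * K := Finset.sum_le_sum hrow
    _ = #S * (#Z * K) := by rw [Finset.sum_const, nsmul_eq_mul]

namespace FermionInteraction

/-- **Norm of a local Hamiltonian**: if every term has `‖Φ X‖ ≤ M` then `‖H_S‖ ≤ 2^{|S|} M` (there are
`2^{|S|}` terms, `Γ` is contractive). [cite: BratteliRobinsonII1997, §6.2.1] -/
theorem norm_localHamiltonian_le (Ψ : FermionInteraction d) {M : ℝ} (hM : ∀ X, ‖Ψ.Φ X‖ ≤ M)
    (S : Finset (Site d)) : ‖Ψ.localHamiltonian S‖ ≤ 2 ^ #S * M := by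
  unfold localHamiltonian
  calc ‖∑ X ∈ S.powerset.attach, fermionEmbed (PolySite.incl (Finset.mem_powerset.1 X.2)) (Ψ.Φ X)‖
      ≤ ∑ X ∈ S.powerset.attach, ‖fermionEmbed (PolySite.incl (Finset.mem_powerset.1 X.2)) (Ψ.Φ X)‖ :=
        norm_sum_le _ _
    _ ≤ ∑ X ∈ S.powerset.attach, M :=
        Finset.sum_le_sum fun X _ => (norm_fermionEmbed_le _ _).trans (hM X.1)
    _ = 2 ^ #S * M := by rw [Finset.sum_const, Finset.card_attach, Finset.card_powerset, nsmul_eq_mul]; push_cast; ring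

/-- **A translation-covariant finite-range interaction has uniformly bounded terms**: `‖Φ X‖ ≤ M` for all
`X`, `M = Σ_{Y ⊆ thicken {0} R} ‖Φ Y‖` (a nonzero term is the translate of a term rooted at the origin, and
`Γ(τ)` is contractive). [cite: BratteliRobinsonII1997, §6.2.1 (finite range, translation invariance)] -/
theorem exists_norm_apply_le (Ψ : FermionInteraction d) {R : ℝ} (hT : Ψ.IsTranslationInvariant)
    (hR : Ψ.HasFiniteRange R) : ∃ M : ℝ, 0 ≤ M ∧ ∀ X, ‖Ψ.Φ X‖ ≤ M := by
  classical
  refine ⟨∑ Y ∈ (thicken ({0} : Finset (Site d)) R).powerset, ‖Ψ.Φ Y‖,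
    Finset.sum_nonneg fun Y _ => norm_nonneg _, fun X => ?_⟩
  by_cases hX : Ψ.Φ X = 0
  · rw [hX, norm_zero]; exact Finset.sum_nonneg fun Y _ => norm_nonneg _
  by_cases hX0 : X = ∅
  · subst hX0
    exact Finset.single_le_sum (f := fun Y => ‖Ψ.Φ Y‖) (fun Y _ => norm_nonneg _)
      (Finset.mem_powerset.2 (Finset.empty_subset _))
  have hne : X.Nonempty := Finset.nonempty_iff_ne_empty.2 hX0
  obtain ⟨y, hy⟩ := hne
  have hsub : shiftSet (-y) X ⊆ thicken ({0} : Finset (Site d)) R := hR.shiftSet_neg_subset_thicken_zero hX hy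
  have key : ‖Ψ.Φ (shiftSet y (shiftSet (-y) X))‖ ≤ ‖Ψ.Φ (shiftSet (-y) X)‖ := by
    rw [hT y (shiftSet (-y) X)]
    exact norm_fermionEmbed_le _ _
  rw [KrausPattern.shiftSet_shiftSet_neg] at key
  exact key.trans (Finset.single_le_sum (f := fun Y => ‖Ψ.Φ Y‖) (fun Y _ => norm_nonneg _)
    (Finset.mem_powerset.2 hsub))

end FermionInteraction

/-- `|thicken S R| ≤ |S| · |box ⌊R⌋|`. [folklore] -/
private theorem card_thicken_le (S : Finset (Site d)) (R : ℝ) : #(thicken S R) ≤ #S * #(box d ⌊R⌋₊) := by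
  classical
  unfold thicken
  refine (Finset.card_biUnion_le).trans ?_
  calc ∑ y ∈ S, #((box d ⌊R⌋₊).image fun v => y + v) ≤ ∑ y ∈ S, #(box d ⌊R⌋₊) :=
        Finset.sum_le_sum fun y _ => Finset.card_image_le
    _ = #S * #(box d ⌊R⌋₊) := by rw [Finset.sum_const, smul_eq_mul]

end Helpers

/-! ### §2. Pencils of pencils -/

namespace FermionInteraction

/-- `(Ψ + a·n) + b·n = Ψ + (a + b)·n`: pencils in the same direction compose additively. [cite: KomaTasaki1994, §1] -/
theorem pencil_pencil (Ψ Ψ₁ : FermionInteraction d) (a b : ℝ) :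
    pencil (pencil Ψ Ψ₁ a) Ψ₁ b = pencil Ψ Ψ₁ (a + b) := by
  cases Ψ with
  | mk Φ =>
    simp only [FermionInteraction.pencil, Complex.ofReal_add, add_smul, add_assoc]

end FermionInteraction

/-! ### §3. The box translation sum of a charged local observable in a ground state at two chemical potentials -/

section Box

open scoped Matrix.Norms.L2Operator

open FermionInteraction

/-- **The key estimate.** Let `K` be an even interaction of range `R ≥ 0`, `ω` a translation-invariant state
that is a Bratteli–Robinson ground state of BOTH `K − δn` and `K + δn` (`δ > 0`), `A ∈ 𝔄_Λ` an even local
observable of gauge charge `q > 0`, and `‖H^K_{thicken (Λ + x) R}‖ ≤ M_H` for all `x`. Then for every finite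
`S ⊆ ℤ^d` (the box of translates), with `Z = {u − a : u ∈ thicken Λ R, a ∈ Λ}`,
`2δq · |S|² ‖ω(A)‖² ≤ |S| · |Z| · 4‖A‖² M_H`: the ground-state inequalities for the translation sum
`B = Σ_{x∈S} τ_x A` (at `K − δn`) and for `B⋆` (at `K + δn`) add up, by stationarity, to
`δq (ω(B⋆B) + ω(BB⋆)) ≤ Re ω([B⋆,[H^K, B]])`; the double commutator only pairs translates at offsets in `Z`
(graded locality and Araki–Moriya's `[H_{Λ'}, A] = [H_{thicken}, A]`), while `ω(B⋆B), ω(BB⋆) ≥ |ω(B)|² =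
|S|²|ω(A)|²` (Cauchy–Schwarz, translation invariance).
[cite: BratteliRobinsonII1997, Prop. 5.3.19 and Thm. 6.2.4] [cite: BratteliKishimotoRobinson1978, §1] -/
theorem InfVolFermionState.IsTranslationInvariant.two_mul_charge_mul_sq_le_of_isGroundState_pencil_two
    {K : FermionInteraction d} {R : ℝ} (hR : 0 ≤ R) (hKE : K.IsEven) (hKR : K.HasFiniteRange R)
    {ω : InfVolFermionState d} (hω : ω.IsTranslationInvariant) {δ : ℝ} (hδ : 0 < δ)
    (hgsP : ω.IsGroundState (pencil K (numberInteraction d) (-δ)) R)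
    (hgsM : ω.IsGroundState (pencil K (numberInteraction d) δ) R)
    {Λ : Finset (Site d)} {A : FermionOp Λ} (hAev : parityAut A = A) {q : ℤ} (hq : 0 < q)
    (hAq : HasGaugeCharge q A) {MH : ℝ} (hMH0 : 0 ≤ MH)
    (hMH : ∀ x : Site d, ‖K.localHamiltonian (thicken (shiftSet x Λ) R)‖ ≤ MH) (S : Finset (Site d)) :
    2 * δ * q * ((#S : ℝ) ^ 2 * ‖ω.expect Λ A‖ ^ 2) ≤
      #S * (#(((thicken Λ R) ×ˢ Λ).image fun p : Site d × Site d => p.1 - p.2) * (4 * ‖A‖ ^ 2 * MH)) := by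
  classical
  -- regions
  set Ω : Finset (Site d) := S.biUnion fun x => shiftSet x Λ with hΩ
  set Λ' : Finset (Site d) := thicken Ω R with hΛ'
  have hxΩ : ∀ x ∈ S, shiftSet x Λ ⊆ Ω := fun x hx => Finset.subset_biUnion_of_mem (fun x => shiftSet x Λ) hx
  have hΩΛ' : Ω ⊆ Λ' := subset_thicken Ω R
  have hTx : ∀ x ∈ S, thicken (shiftSet x Λ) R ⊆ Λ' := fun x hx =>
    thicken_subset_thicken_of_subset (hxΩ x hx) R
  have hxΛ' : ∀ x ∈ S, shiftSet x Λ ⊆ Λ' := fun x hx => (hxΩ x hx).trans hΩΛ'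
  -- the translates
  set τA : (x : Site d) → FermionOp (shiftSet x Λ) := fun x => fermionEmbed (PolySite.shiftEmb x Λ) A with hτA
  have hτAev : ∀ x, parityAut (τA x) = τA x := fun x => by
    rw [hτA, ← fermionEmbed_parityAut, hAev]
  have hτAq : ∀ x, HasGaugeCharge q (τA x) := fun x => hAq.fermionEmbed _
  set b : Site d → FermionOp Ω := fun x =>
    if hx : x ∈ S then fermionEmbed (PolySite.incl (hxΩ x hx)) (τA x) else 0 with hb
  set bt : Site d → FermionOp Λ' := fun x =>
    if hx : x ∈ S then fermionEmbed (PolySite.incl (hxΛ' x hx)) (τA x) else 0 with hbt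
  set B : FermionOp Ω := ∑ x ∈ S, b x with hB
  set Bt : FermionOp Λ' := fermionEmbed (PolySite.incl hΩΛ') B with hBt
  have hbt_of_mem : ∀ x (hx : x ∈ S), bt x = fermionEmbed (PolySite.incl (hxΛ' x hx)) (τA x) := fun x hx => by
    simp only [hbt, dif_pos hx]
  have hBt_sum : Bt = ∑ x ∈ S, bt x := by
    rw [hBt, hB, map_sum]
    refine Finset.sum_congr rfl fun x hx => ?_
    simp only [hb, hbt, dif_pos hx]
    rw [fermionEmbed_fermionEmbed, PolySite.incl_trans]
  -- charges
  have hBtq : HasGaugeCharge q Bt := by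
    rw [hBt_sum]
    exact HasGaugeCharge.sum S fun x hx => by rw [hbt_of_mem x hx]; exact (hτAq x).fermionEmbed _
  set N : FermionOp Λ' := totalNumber with hN
  have hNBt : N * Bt - Bt * N = (q : ℂ) • Bt := by
    have h := hasGaugeCharge_iff_commutator.1 hBtq
    rwa [totalNumberOp_eq_totalNumber] at h
  have hNBtH : N * Btᴴ - Btᴴ * N = (-(q : ℂ)) • Btᴴ := by
    have h := hasGaugeCharge_iff_commutator.1 hBtq.conjTranspose
    rw [totalNumberOp_eq_totalNumber] at h
    rw [h]; push_cast; rfl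
  -- Hamiltonians
  set H : FermionOp Λ' := K.localHamiltonian Λ' with hH
  have hpE : ∀ s : ℝ, (pencil K (numberInteraction d) s).IsEven := fun s =>
    isEven_pencil hKE numberInteraction_isEven s
  have hpR : ∀ s : ℝ, (pencil K (numberInteraction d) s).HasFiniteRange R := fun s =>
    hasFiniteRange_pencil hKR (numberInteraction_hasFiniteRange R hR) s
  have hHp : ∀ s : ℝ, (pencil K (numberInteraction d) s).localHamiltonian Λ' = H + (s : ℂ) • N := fun s => by
    rw [localHamiltonian_pencil, numberInteraction_localHamiltonian]
  -- the two ground-state inequalities and stationarity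
  have gP := hgsP.re_expect_conj_commutator_nonneg_of_thicken_subset (hpE _) (hpR _) (subset_refl Λ') B
  have gM := hgsM.re_expect_conj_commutator_nonneg_of_thicken_subset (hpE _) (hpR _) (subset_refl Λ') Bᴴ
  have st := hgsM.expect_commutator_localHamiltonian_eq_zero_of_thicken_subset (hpE _) (hpR _)
    (subset_refl Λ') (B * Bᴴ)
  rw [hHp] at gP gM st
  change 0 ≤ (ω.expect Λ' (Btᴴ * ((H + ((-δ : ℝ) : ℂ) • N) * Bt - Bt * (H + ((-δ : ℝ) : ℂ) • N)))).re at gP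
  rw [fermionEmbed_conjTranspose] at gM
  change 0 ≤ (ω.expect Λ' (Btᴴᴴ * ((H + (δ : ℂ) • N) * Btᴴ - Btᴴ * (H + (δ : ℂ) • N)))).re at gM
  rw [Matrix.conjTranspose_conjTranspose] at gM
  rw [map_mul, fermionEmbed_conjTranspose] at st
  change ω.expect Λ' ((H + (δ : ℂ) • N) * (Bt * Btᴴ) - (Bt * Btᴴ) * (H + (δ : ℂ) • N)) = 0 at st
  -- algebra: isolate the `H`-parts
  have eP : Btᴴ * ((H + ((-δ : ℝ) : ℂ) • N) * Bt - Bt * (H + ((-δ : ℝ) : ℂ) • N)) =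
      Btᴴ * (H * Bt - Bt * H) + (((-δ * q : ℝ)) : ℂ) • (Btᴴ * Bt) := by
    have : (H + ((-δ : ℝ) : ℂ) • N) * Bt - Bt * (H + ((-δ : ℝ) : ℂ) • N) =
        (H * Bt - Bt * H) + ((-δ : ℝ) : ℂ) • (N * Bt - Bt * N) := by
      rw [add_mul, mul_add, Matrix.smul_mul, Matrix.mul_smul, smul_sub]; abel
    rw [this, hNBt, smul_smul, mul_add, Matrix.mul_smul]
    push_cast; ring_nf
  have eM : Bt * ((H + (δ : ℂ) • N) * Btᴴ - Btᴴ * (H + (δ : ℂ) • N)) =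
      Bt * (H * Btᴴ - Btᴴ * H) + (((-δ * q : ℝ)) : ℂ) • (Bt * Btᴴ) := by
    have : (H + (δ : ℂ) • N) * Btᴴ - Btᴴ * (H + (δ : ℂ) • N) =
        (H * Btᴴ - Btᴴ * H) + (δ : ℂ) • (N * Btᴴ - Btᴴ * N) := by
      rw [add_mul, mul_add, Matrix.smul_mul, Matrix.mul_smul, smul_sub]; abel
    rw [this, hNBtH, smul_smul, mul_add, Matrix.mul_smul]
    push_cast; ring_nf
  have eS : (H + (δ : ℂ) • N) * (Bt * Btᴴ) - (Bt * Btᴴ) * (H + (δ : ℂ) • N) =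
      H * (Bt * Btᴴ) - (Bt * Btᴴ) * H := by
    have hc : N * (Bt * Btᴴ) - (Bt * Btᴴ) * N = 0 := by
      have : N * (Bt * Btᴴ) - (Bt * Btᴴ) * N = (N * Bt - Bt * N) * Btᴴ + Bt * (N * Btᴴ - Btᴴ * N) := by
        rw [sub_mul, mul_sub]; simp only [Matrix.mul_assoc]; abel
      rw [this, hNBt, hNBtH, Matrix.smul_mul, Matrix.mul_smul, neg_smul, add_neg_cancel]
    rw [add_mul, mul_add, Matrix.smul_mul, Matrix.mul_smul]
    rw [sub_eq_zero] at hc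
    rw [hc]; abel
  rw [eP, map_add, map_smul, Complex.add_re, smul_eq_mul, Complex.re_ofReal_mul] at gP
  rw [eM, map_add, map_smul, Complex.add_re, smul_eq_mul, Complex.re_ofReal_mul] at gM
  rw [eS] at st
  -- the double commutator
  set D : FermionOp Λ' := Btᴴ * (H * Bt - Bt * H) - (H * Bt - Bt * H) * Btᴴ with hD
  have hPQ : Btᴴ * (H * Bt - Bt * H) + Bt * (H * Btᴴ - Btᴴ * H) = D + (H * (Bt * Btᴴ) - (Bt * Btᴴ) * H) := by
    rw [hD]; noncomm_ring
  have hsum : δ * q * ((ω.expect Λ' (Btᴴ * Bt)).re + (ω.expect Λ' (Bt * Btᴴ)).re) ≤ (ω.expect Λ' D).re := by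
    have h := add_nonneg gP gM
    rw [show (ω.expect Λ' (Btᴴ * (H * Bt - Bt * H))).re + -δ * ↑q * (ω.expect Λ' (Btᴴ * Bt)).re +
        ((ω.expect Λ' (Bt * (H * Btᴴ - Btᴴ * H))).re + -δ * ↑q * (ω.expect Λ' (Bt * Btᴴ)).re) =
        (ω.expect Λ' (Btᴴ * (H * Bt - Bt * H)) + ω.expect Λ' (Bt * (H * Btᴴ - Btᴴ * H))).re -
          δ * q * ((ω.expect Λ' (Btᴴ * Bt)).re + (ω.expect Λ' (Bt * Btᴴ)).re) by
      rw [Complex.add_re]; ring] at h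
    rw [← map_add, hPQ, map_add, st, add_zero] at h
    linarith
  -- lower bound: Cauchy–Schwarz and translation invariance
  have hωbt : ∀ x ∈ S, ω.expect Λ' (bt x) = ω.expect Λ A := fun x hx => by
    rw [hbt_of_mem x hx, ω.compatible, hτA]
    exact hω.expect_fermionEmbed_shiftEmb x Λ A
  have hωBt : ω.expect Λ' Bt = (#S : ℂ) * ω.expect Λ A := by
    rw [hBt_sum, map_sum, Finset.sum_congr rfl hωbt, Finset.sum_const, nsmul_eq_mul]
  have hlow : 2 * ((#S : ℝ) ^ 2 * ‖ω.expect Λ A‖ ^ 2) ≤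
      (ω.expect Λ' (Btᴴ * Bt)).re + (ω.expect Λ' (Bt * Btᴴ)).re := by
    have h1 := ω.norm_sq_expect_le_re_expect_conjTranspose_mul_self Λ' Bt
    have h2 := ω.norm_sq_expect_le_re_expect_mul_conjTranspose_self Λ' Bt
    rw [hωBt, norm_mul, Complex.norm_natCast, mul_pow] at h1 h2
    linarith
  -- upper bound: expansion of the double commutator into pairs of translates
  set c : Site d → FermionOp Λ' := fun x => H * bt x - bt x * H with hc
  have hDsum : D = ∑ x ∈ S, ∑ y ∈ S, ((bt y)ᴴ * c x - c x * (bt y)ᴴ) := by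
    have hcomm : H * Bt - Bt * H = ∑ x ∈ S, c x := by
      rw [hBt_sum, Finset.mul_sum, Finset.sum_mul, ← Finset.sum_sub_distrib]
    have hBtH : Btᴴ = ∑ y ∈ S, (bt y)ᴴ := by rw [hBt_sum, Matrix.conjTranspose_sum]
    have h1 : Btᴴ * (∑ x ∈ S, c x) = ∑ x ∈ S, ∑ y ∈ S, (bt y)ᴴ * c x := by
      rw [hBtH, Finset.sum_mul]; simp_rw [Finset.mul_sum]; exact Finset.sum_comm
    have h2 : (∑ x ∈ S, c x) * Btᴴ = ∑ x ∈ S, ∑ y ∈ S, c x * (bt y)ᴴ := by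
      rw [hBtH, Finset.sum_mul]; simp_rw [Finset.mul_sum]
    rw [hD, hcomm, h1, h2, ← Finset.sum_sub_distrib]
    refine Finset.sum_congr rfl fun x _ => ?_
    rw [← Finset.sum_sub_distrib]
  -- locality of the single commutators
  have hcx : ∀ x (hx : x ∈ S), c x = fermionEmbed (PolySite.incl (hTx x hx))
      (K.localHamiltonian (thicken (shiftSet x Λ) R) *
          fermionEmbed (PolySite.incl (subset_thicken (shiftSet x Λ) R)) (τA x) -
        fermionEmbed (PolySite.incl (subset_thicken (shiftSet x Λ) R)) (τA x) *
          K.localHamiltonian (thicken (shiftSet x Λ) R)) := fun x hx => by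
    rw [hc]
    simp only [hbt_of_mem x hx, hH]
    exact K.localHamiltonian_commutator_fermionEmbed_eq_of_thicken_subset hKE hKR (hTx x hx) (τA x)
  -- far pairs vanish
  set Z : Finset (Site d) := ((thicken Λ R) ×ˢ Λ).image fun p : Site d × Site d => p.1 - p.2 with hZ
  have hfar : ∀ x ∈ S, ∀ y ∈ S, y - x ∉ Z →
      ω.expect Λ' ((bt y)ᴴ * c x - c x * (bt y)ᴴ) = 0 := by
    intro x hx y hy hxy
    have hdisj : Disjoint (shiftSet y Λ) (thicken (shiftSet x Λ) R) := by
      rw [Finset.disjoint_left]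
      intro z hzy hzx
      apply hxy
      rw [mem_shiftSet] at hzy
      obtain ⟨s, hs, w, hw, hswz⟩ := mem_thicken_iff.1 hzx
      rw [mem_shiftSet] at hs
      rw [hZ, Finset.mem_image]
      refine ⟨(s - x + w, z - y), Finset.mem_product.2 ⟨?_, hzy⟩, ?_⟩
      · exact mem_thicken_iff.2 ⟨s - x, hs, w, hw, rfl⟩
      · simp only
        rw [← hswz]; abel
    have hcomm : Commute (fermionEmbed (PolySite.incl (hxΛ' y hy)) (τA y))ᴴ (c x) := by
      rw [hcx x hx, ← fermionEmbed_conjTranspose]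
      refine commute_fermionEmbed_incl_of_disjoint ?_ (hxΛ' y hy) (hTx x hx) hdisj _
      rw [parityAut_conjTranspose, hτAev]
    rw [hbt_of_mem y hy, sub_eq_zero.2 hcomm.eq, map_zero]
  -- near pairs are bounded
  have hτAnorm : ∀ x, ‖τA x‖ ≤ ‖A‖ := fun x => norm_fermionEmbed_le _ _
  have hnear : ∀ x ∈ S, ∀ y ∈ S, ‖ω.expect Λ' ((bt y)ᴴ * c x - c x * (bt y)ᴴ)‖ ≤ 4 * ‖A‖ ^ 2 * MH := by
    intro x hx y hy
    have hbty : ‖(bt y)ᴴ‖ ≤ ‖A‖ := by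
      rw [Matrix.l2_opNorm_conjTranspose, hbt_of_mem y hy]
      exact (norm_fermionEmbed_le _ _).trans (hτAnorm y)
    have hcxn : ‖c x‖ ≤ 2 * MH * ‖A‖ := by
      rw [hcx x hx]
      refine (norm_fermionEmbed_le _ _).trans ((norm_sub_le _ _).trans ?_)
      have h1 := norm_mul_le (K.localHamiltonian (thicken (shiftSet x Λ) R))
        (fermionEmbed (PolySite.incl (subset_thicken (shiftSet x Λ) R)) (τA x))
      have h2 := norm_mul_le (fermionEmbed (PolySite.incl (subset_thicken (shiftSet x Λ) R)) (τA x))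
        (K.localHamiltonian (thicken (shiftSet x Λ) R))
      have h3 : ‖fermionEmbed (PolySite.incl (subset_thicken (shiftSet x Λ) R)) (τA x)‖ ≤ ‖A‖ :=
        (norm_fermionEmbed_le _ _).trans (hτAnorm x)
      have h4 := hMH x
      nlinarith [norm_nonneg (fermionEmbed (PolySite.incl (subset_thicken (shiftSet x Λ) R)) (τA x)),
        norm_nonneg (K.localHamiltonian (thicken (shiftSet x Λ) R)), norm_nonneg A]
    refine (ω.norm_expect_le Λ' _).trans ((norm_sub_le _ _).trans ?_)
    have h1 := norm_mul_le ((bt y)ᴴ) (c x)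
    have h2 := norm_mul_le (c x) ((bt y)ᴴ)
    nlinarith [norm_nonneg ((bt y)ᴴ), norm_nonneg (c x), norm_nonneg A]
  have hup : ‖ω.expect Λ' D‖ ≤ #S * (#Z * (4 * ‖A‖ ^ 2 * MH)) := by
    rw [hDsum]
    simp only [map_sum]
    exact norm_sum_sum_le_card_mul_of_sub_mem S Z (fun x y => ω.expect Λ' ((bt y)ᴴ * c x - c x * (bt y)ᴴ))
      (by positivity) hfar hnear
  -- assemble
  have hq' : (0 : ℝ) < q := by exact_mod_cast hq
  calc 2 * δ * q * ((#S : ℝ) ^ 2 * ‖ω.expect Λ A‖ ^ 2)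
      = δ * q * (2 * ((#S : ℝ) ^ 2 * ‖ω.expect Λ A‖ ^ 2)) := by ring
    _ ≤ δ * q * ((ω.expect Λ' (Btᴴ * Bt)).re + (ω.expect Λ' (Bt * Btᴴ)).re) :=
        mul_le_mul_of_nonneg_left hlow (by positivity)
    _ ≤ (ω.expect Λ' D).re := hsum
    _ ≤ ‖ω.expect Λ' D‖ := Complex.re_le_norm _
    _ ≤ #S * (#Z * (4 * ‖A‖ ^ 2 * MH)) := hup

end Box

/-! ### §4. Ground states at two chemical potentials annihilate every charged observable -/

section TwoChemicalPotentials

open scoped Matrix.Norms.L2Operator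

open FermionInteraction

namespace InfVolFermionState

/-- **Even observables of positive charge** (the case carrying the argument): for `Ψ` even, of range `R ≥ 0`
and translation covariant on `ℤ^d` (`d ≥ 1`), a translation-invariant state that is a Bratteli–Robinson
ground state of `Ψ − μ₁n` AND of `Ψ − μ₂n` with `μ₁ < μ₂` vanishes on every even local observable of gauge
charge `q > 0`. (The key estimate `two_mul_charge_mul_sq_le_of_isGroundState_pencil_two` for the recentred
pencil `K = Ψ − ½(μ₁+μ₂)n`, `δ = ½(μ₂−μ₁)`, on the boxes `[0,ℓ)^d`: `2δq ℓ^{2d}|ω(A)|² ≤ C ℓ^d` for all `ℓ`.)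
[cite: BratteliRobinsonII1997, Prop. 5.3.19] [cite: BratteliKishimotoRobinson1978, §1] -/
theorem IsTranslationInvariant.expect_eq_zero_of_parityAut_eq_of_pos_charge_of_isGroundState_pencil_two
    (hd : 0 < d) {Ψ : FermionInteraction d} {R : ℝ} (hR : 0 ≤ R) (hE : Ψ.IsEven) (hF : Ψ.HasFiniteRange R)
    (hT : Ψ.IsTranslationInvariant) {ω : InfVolFermionState d} (hω : ω.IsTranslationInvariant) {μ₁ μ₂ : ℝ}
    (hμ : μ₁ < μ₂) (h₁ : ω.IsGroundState (pencil Ψ (numberInteraction d) (-μ₁)) R)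
    (h₂ : ω.IsGroundState (pencil Ψ (numberInteraction d) (-μ₂)) R)
    {Λ : Finset (Site d)} {A : FermionOp Λ} (hAev : parityAut A = A) {q : ℤ} (hq : 0 < q)
    (hAq : HasGaugeCharge q A) : ω.expect Λ A = 0 := by
  classical
  -- recentre the chemical potential
  set δ : ℝ := (μ₂ - μ₁) / 2 with hδdef
  have hδ : 0 < δ := by rw [hδdef]; linarith
  set K : FermionInteraction d := pencil Ψ (numberInteraction d) (-((μ₁ + μ₂) / 2)) with hK
  have hKE : K.IsEven := isEven_pencil hE numberInteraction_isEven _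
  have hKR : K.HasFiniteRange R := hasFiniteRange_pencil hF (numberInteraction_hasFiniteRange R hR) _
  have hKT : K.IsTranslationInvariant := isTranslationInvariant_pencil hT numberInteraction_isTranslationInvariant _
  have hKP : pencil K (numberInteraction d) (-δ) = pencil Ψ (numberInteraction d) (-μ₂) := by
    rw [hK, pencil_pencil]; congr 1; rw [hδdef]; ring
  have hKM : pencil K (numberInteraction d) δ = pencil Ψ (numberInteraction d) (-μ₁) := by
    rw [hK, pencil_pencil]; congr 1; rw [hδdef]; ring
  have hgsP : ω.IsGroundState (pencil K (numberInteraction d) (-δ)) R := by rw [hKP]; exact h₂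
  have hgsM : ω.IsGroundState (pencil K (numberInteraction d) δ) R := by rw [hKM]; exact h₁
  -- a uniform bound on the local Hamiltonians of `K` over thickened translates of `Λ`
  obtain ⟨M, hM0, hM⟩ := K.exists_norm_apply_le hKT hKR
  set MH : ℝ := 2 ^ (#Λ * #(box d ⌊R⌋₊)) * M with hMHdef
  have hMH0 : 0 ≤ MH := by positivity
  have hMH : ∀ x : Site d, ‖K.localHamiltonian (thicken (shiftSet x Λ) R)‖ ≤ MH := fun x => by
    refine (K.norm_localHamiltonian_le hM _).trans ?_
    have hcard : #(thicken (shiftSet x Λ) R) ≤ #Λ * #(box d ⌊R⌋₊) :=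
      (card_thicken_le _ _).trans (by rw [card_shiftSet])
    exact mul_le_mul_of_nonneg_right (pow_le_pow_right₀ one_le_two hcard) hM0
  -- the estimate on every box
  set C : ℝ := #(((thicken Λ R) ×ˢ Λ).image fun p : Site d × Site d => p.1 - p.2) * (4 * ‖A‖ ^ 2 * MH)
    with hC
  have hC0 : 0 ≤ C := by positivity
  have key : ∀ ℓ : ℕ, 2 * δ * q * ((((ℓ : ℝ) ^ d) ^ 2) * ‖ω.expect Λ A‖ ^ 2) ≤ (ℓ : ℝ) ^ d * C := by
    intro ℓ
    have h := hω.two_mul_charge_mul_sq_le_of_isGroundState_pencil_two hR hKE hKR hδ hgsP hgsM hAev hq hAq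
      hMH0 hMH (halfOpenBox d ℓ)
    rw [card_halfOpenBox] at h
    push_cast at h
    exact h
  -- conclusion
  by_contra hne
  have hm : 0 < ‖ω.expect Λ A‖ ^ 2 := by positivity
  have hq' : (0 : ℝ) < q := by exact_mod_cast hq
  obtain ⟨ℓ, hℓ⟩ := exists_nat_gt (C / (2 * δ * q * ‖ω.expect Λ A‖ ^ 2))
  have hℓ1 : 1 ≤ ℓ := by
    have : (0 : ℝ) < ℓ := lt_of_le_of_lt (by positivity) hℓ
    exact Nat.one_le_iff_ne_zero.2 (by rintro rfl; simp at this)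
  have hℓd : (ℓ : ℝ) ≤ (ℓ : ℝ) ^ d := by
    exact_mod_cast Nat.le_self_pow (Nat.pos_iff_ne_zero.1 hd) ℓ
  have hP : (0 : ℝ) < (ℓ : ℝ) ^ d := by
    have : (0 : ℝ) < ℓ := by exact_mod_cast hℓ1
    positivity
  have h1 := key ℓ
  -- `2δq ℓ^d m ≤ C`
  have h2 : 2 * δ * q * ‖ω.expect Λ A‖ ^ 2 * (ℓ : ℝ) ^ d ≤ C := by
    have : 2 * δ * q * ‖ω.expect Λ A‖ ^ 2 * (ℓ : ℝ) ^ d * (ℓ : ℝ) ^ d ≤ C * (ℓ : ℝ) ^ d := by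
      nlinarith [h1]
    exact le_of_mul_le_mul_right this hP
  have h3 : (ℓ : ℝ) ^ d ≤ C / (2 * δ * q * ‖ω.expect Λ A‖ ^ 2) := by
    rw [le_div_iff₀ (by positivity)]
    linarith [h2]
  linarith

/-- **A translation-invariant ground state at two chemical potentials annihilates every charged local
observable.** For `Ψ` even, of range `R ≥ 0` and translation covariant on `ℤ^d` (`d ≥ 1`): if `ω` is translation
invariant and a Bratteli–Robinson ground state of both `Ψ − μ₁n` and `Ψ − μ₂n`, `μ₁ < μ₂`, then `ω(A) = 0` for
every local `A` of gauge charge `q ≠ 0` (odd charge: `A` is odd and translation-invariant states are even;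
even charge: the box estimate, for `A` or `Aᴴ`). Physically: a density at which the energy density has a kink
(two supporting chemical potentials) carries no `U(1)`-breaking order — incompressible ⇒ not superfluid.
[cite: BratteliRobinsonII1997, Prop. 5.3.19 and §5.2.2] [cite: ArakiMoriya2003, §4.1 Def. 4.5 Remark 1] -/
theorem IsTranslationInvariant.expect_eq_zero_of_hasGaugeCharge_of_isGroundState_pencil_two
    (hd : 0 < d) {Ψ : FermionInteraction d} {R : ℝ} (hR : 0 ≤ R) (hE : Ψ.IsEven) (hF : Ψ.HasFiniteRange R)
    (hT : Ψ.IsTranslationInvariant) {ω : InfVolFermionState d} (hω : ω.IsTranslationInvariant) {μ₁ μ₂ : ℝ}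
    (hμ : μ₁ < μ₂) (h₁ : ω.IsGroundState (pencil Ψ (numberInteraction d) (-μ₁)) R)
    (h₂ : ω.IsGroundState (pencil Ψ (numberInteraction d) (-μ₂)) R)
    {Λ : Finset (Site d)} {q : ℤ} (hq : q ≠ 0) {A : FermionOp Λ} (hAq : HasGaugeCharge q A) :
    ω.expect Λ A = 0 := by
  have hπ := hAq Real.pi
  rw [gaugeAut_pi] at hπ
  rcases Int.even_or_odd q with ⟨k, hk⟩ | ⟨k, hk⟩
  · -- even charge: `A` is even
    have hAev : parityAut A = A := by
      rw [hπ, hk, show I * (Real.pi : ℂ) * ((k + k : ℤ) : ℂ) = (k : ℂ) * (2 * Real.pi * I) by push_cast; ring,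
        Complex.exp_int_mul_two_pi_mul_I, one_smul]
    rcases lt_or_gt_of_ne hq with hneg | hpos
    · have h0 := hω.expect_eq_zero_of_parityAut_eq_of_pos_charge_of_isGroundState_pencil_two hd hR hE hF hT hμ
        h₁ h₂ (A := Aᴴ) (by rw [parityAut_conjTranspose, hAev]) (neg_pos.2 hneg) hAq.conjTranspose
      rw [ω.expect_conjTranspose] at h0
      simpa using congrArg star h0
    · exact hω.expect_eq_zero_of_parityAut_eq_of_pos_charge_of_isGroundState_pencil_two hd hR hE hF hT hμ h₁ h₂
        hAev hpos hAq
  · -- odd charge: `A` is odd, and translation-invariant states are even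
    have hAodd : parityAut A = -A := by
      rw [hπ, hk, show I * (Real.pi : ℂ) * ((2 * k + 1 : ℤ) : ℂ) = (k : ℂ) * (2 * Real.pi * I) + Real.pi * I by
        push_cast; ring, Complex.exp_add, Complex.exp_int_mul_two_pi_mul_I, Complex.exp_pi_mul_I, one_mul,
        neg_one_smul]
    exact (hω.isEven hd).expect_eq_zero_of_odd hAodd

/-- **GROUND STATES AT TWO CHEMICAL POTENTIALS ARE GAUGE INVARIANT.** `Ψ` even, range `R ≥ 0`, translation
covariant on `ℤ^d`, `d ≥ 1`; `ω` translation invariant and a Bratteli–Robinson ground state of `Ψ − μ₁n` and of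
`Ψ − μ₂n`, `μ₁ < μ₂` ⇒ `ω ∘ γ_θ = ω` for every gauge rotation. In the tree's language of mean-energy minimisers
(`TorusLimitAsymptoticGroundStateFamilies`): a translation-invariant minimiser at a density where the subdifferential
of the energy density is a nondegenerate interval (a CHARGE GAP) breaks no particle-number symmetry.
[cite: BratteliRobinsonII1997, Prop. 5.3.19 and §5.2.2] [cite: BratteliKishimotoRobinson1978, Thm. 2 (p. 47)] -/
theorem IsTranslationInvariant.isGaugeInvariant_of_isGroundState_pencil_two
    (hd : 0 < d) {Ψ : FermionInteraction d} {R : ℝ} (hR : 0 ≤ R) (hE : Ψ.IsEven) (hF : Ψ.HasFiniteRange R)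
    (hT : Ψ.IsTranslationInvariant) {ω : InfVolFermionState d} (hω : ω.IsTranslationInvariant) {μ₁ μ₂ : ℝ}
    (hμ : μ₁ < μ₂) (h₁ : ω.IsGroundState (pencil Ψ (numberInteraction d) (-μ₁)) R)
    (h₂ : ω.IsGroundState (pencil Ψ (numberInteraction d) (-μ₂)) R) : ω.IsGaugeInvariant := by
  classical
  refine isGaugeInvariant_of_forall_expect_commutator fun Λ A => ?_
  rw [Matrix.matrix_eq_sum_single A, Finset.mul_sum, Finset.sum_mul, ← Finset.sum_sub_distrib, map_sum]
  refine Finset.sum_eq_zero fun s _ => ?_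
  rw [Finset.mul_sum, Finset.sum_mul, ← Finset.sum_sub_distrib, map_sum]
  refine Finset.sum_eq_zero fun t _ => ?_
  rw [hasGaugeCharge_iff_commutator.1 (hasGaugeCharge_single s t (A s t)), map_smul, smul_eq_mul]
  by_cases hst : (s.card : ℤ) - t.card = 0
  · rw [hst, Int.cast_zero, zero_mul]
  · rw [hω.expect_eq_zero_of_hasGaugeCharge_of_isGroundState_pencil_two hd hR hE hF hT hμ h₁ h₂ hst
      (hasGaugeCharge_single s t (A s t)), mul_zero]

end InfVolFermionState

end TwoChemicalPotentials

/-! ### §5. The `t–t'` Hubbard model on `ℤ²` -/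

section Hubbard

namespace InfVolFermionState

/-- **Two supporting chemical potentials ⇒ gauge invariance, for `H^{tt'} − μN`.** A translation-invariant
state of the lattice fermions on `ℤ²` that is a Bratteli–Robinson ground state of `hubbardTTPrimeMuInteraction t t' U μ`
for two values `μ₁ < μ₂` is gauge invariant. With `TorusLimitAsymptoticGroundStateFamilies` /
`TorusLimitSectorGroundStatesChargedRows` (torus limits of asymptotically-ground-state families at density `n`
are ground states of `H^{tt'} − μN` for EVERY `μ ∈ [μ₋(n), μ₊(n)]`): at a density with a charge gap
(`μ₋(n) < μ₊(n)`) every such limit is gauge invariant. [cite: BratteliRobinsonII1997, Prop. 5.3.19 and §5.2.2]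
[cite: BratteliKishimotoRobinson1978, Thm. 2 (p. 47)] -/
theorem IsTranslationInvariant.isGaugeInvariant_of_isGroundState_hubbardTTPrimeMu_two (t t' U : ℝ)
    {ω : InfVolFermionState 2} (hω : ω.IsTranslationInvariant) {μ₁ μ₂ : ℝ} (hμ : μ₁ < μ₂)
    (h₁ : ω.IsGroundState (hubbardTTPrimeMuInteraction t t' U μ₁) 1)
    (h₂ : ω.IsGroundState (hubbardTTPrimeMuInteraction t t' U μ₂) 1) : ω.IsGaugeInvariant :=
  hω.isGaugeInvariant_of_isGroundState_pencil_two two_pos zero_le_one (hubbardTTPrimeFermionInteraction_isEven t t' U)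
    (hubbardTTPrimeFermionInteraction_hasFiniteRange t t' U)
    (hubbardTTPrimeFermionInteraction_isTranslationInvariant t t' U) hμ h₁ h₂

/-- **… hence every charged local expectation vanishes** (`q ≠ 0`). [cite: BratteliRobinsonII1997, §5.2.2] -/
theorem IsTranslationInvariant.expect_eq_zero_of_hasGaugeCharge_of_isGroundState_hubbardTTPrimeMu_two
    (t t' U : ℝ) {ω : InfVolFermionState 2} (hω : ω.IsTranslationInvariant) {μ₁ μ₂ : ℝ} (hμ : μ₁ < μ₂)
    (h₁ : ω.IsGroundState (hubbardTTPrimeMuInteraction t t' U μ₁) 1)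
    (h₂ : ω.IsGroundState (hubbardTTPrimeMuInteraction t t' U μ₂) 1) {Λ : Finset (Site 2)} {q : ℤ}
    (hq : q ≠ 0) {A : FermionOp Λ} (hA : HasGaugeCharge q A) : ω.expect Λ A = 0 :=
  (hω.isGaugeInvariant_of_isGroundState_hubbardTTPrimeMu_two t t' U hμ h₁ h₂).expect_eq_zero_of_hasGaugeCharge hq hA

/-- **… in particular every local singlet-pair amplitude vanishes**: `ω(P_x^g) = 0` for the pair operator
`localPairAt S g x` of any form factor (charge `−2`) — no `d`-wave (or `s`-, extended-`s`-, …) pair amplitude in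
a translation-invariant ground state with two supporting chemical potentials.
[cite: BratteliRobinsonII1997, §5.2.2] [cite: KomaTasaki1994, §1] -/
theorem IsTranslationInvariant.expect_localPairAt_eq_zero_of_isGroundState_hubbardTTPrimeMu_two (t t' U : ℝ)
    {ω : InfVolFermionState 2} (hω : ω.IsTranslationInvariant) {μ₁ μ₂ : ℝ} (hμ : μ₁ < μ₂)
    (h₁ : ω.IsGroundState (hubbardTTPrimeMuInteraction t t' U μ₁) 1)
    (h₂ : ω.IsGroundState (hubbardTTPrimeMuInteraction t t' U μ₂) 1) (S : Finset (Site 2)) (g : Site 2 → ℝ)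
    (x : Site 2) : ω.expect (pairRegion S x) (localPairAt S g x) = 0 :=
  (hω.isGaugeInvariant_of_isGroundState_hubbardTTPrimeMu_two t t' U hμ h₁ h₂).expect_localPairAt_eq_zero S g x

end InfVolFermionState

end Hubbard

end Literature.MathematicalPhysics.QuantumLattice

end
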